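import Summits.QuantumFields.BalabanUV.Beta.CompositeOneShotJets
import Summits.QuantumFields.BalabanUV.Beta.CombOneShotJetsTabs

/-!
# `BalabanUV.Beta.CompositeOneShotTablesAnchor` — row D1 ∕ (C1), file F6d part 1c: **(H-2) — THE DEPTH-ONE COMPOSITE TABLE RECORD IS THE (0.4) RECORD**,
# `tabsComp ctrOff Lc 1 (cΛ·wM1) ≅ symTablesAn1S2 3 Lc cΛ` along `Lc¹ = Lc`, and the transported one-shot kernel identity

WHY (located).  F6D SPEC FINAL §3 ∕ F6d-2's LOCATED note: the (β1) tower's `_anchored` junction takes `hN` from storey `0` on; `hN 0` is the DEPTH-1 IDENTITY made of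
(H-1) the chart at the sym corrector (after K-U3d's `psiKSym`), (H-2) THE TABLES: the depth-one composite record `tabsComp r Lc 1 (cM 1)` over the composite sym tables
IS an1's (0.4) record `symTablesAn1S2 3 Lc cΛ` at `r = ctrOff`, `cM 1 = cΛ·wM1` — the four anchors of F6d-1b (`compV_one ∕ compH_one ∕ compB_ctrOff_one ∕ compMix_one`)
assembled into ONE record identity and transported along `Lc¹ = Lc` in the `HEq` currency of `CombOneShotJetsTabs` — and (H-3) the pins.  This file is (H-2), typed.

WHAT ([folklore] packaging BY NAME; no definition):
* §1 `symTables_ext` — a `SymTables d L` record is determined by its five data fields (the ten letter fields are propositions); `symTables_heq_of_fields` —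
  across an equality of blockings `n = m`, two records with equal data fields are `HEq` (the data fields' types do not mention the blocking).
* §2 **`tabsComp_one_heq_symTablesAn1S2`**: `HEq (tabsComp (r := ctrOff 4 Lc) 1 hLc hr (fun j => cΛ * wM1 3 Lc j)) (symTablesAn1S2 3 Lc cΛ)` — field by field:
  V (`compV_one`, `ctr = toSite ∘ ctrOff` `rfl`), H (`compH_one`), M (`tabsOf`'s `cM j • H` vs `M1Of_apply`), vh₂S (`compB_ctrOff_one`), mixFF (`compMix_one`).
* §3 **`TOf_JsB12CombShSym_tabsComp_one`**: the (III′) literal's level-0 one-shot kernel over the depth-one composite record at blocking `Lc¹` EQUALS the one over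
  `symTablesAn1S2 3 Lc cΛ` at blocking `Lc` (`CombOneShotJetsTabs.TOf_JsB12CombShSym_congr_heq`); **`TshotOf_JcOfTabs_one_of_tabsComp`**: for any scale-indexed record
  whose scale-1 member is the depth-one composite record, `TshotOf Lc (JcOfTabs hLc N tabs cΛ cB) 1 = TbalOf Lc (JsB12CombShSym hLc N (symTablesAn1S2 3 Lc (cΛ 1)) (cΛ 1) (cB 1)) 0`
  (= `hbase` of ROOT M‴ through `TshotOf_JcOfTabs_one`).
WHAT THIS IS NOT: not (H-1) (the chart identity needs `psiKSym`), not (H-3) (pins are parameters), not `hN 0` itself; nothing of Bałaban's asserted, valued or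
discharged; 0 estimates; 0∕4 row-D1 binders; RECORD = ROOT M‴ UNCHANGED; NOT (C1) complete, NOT D1, NEVER «G-an2-4 closed», NOT BetaPertH, NOT continuum, NOT Clay.

HONEST DEPENDENCY (page 1, mandatory): continuum YM on T⁴ ⇐ BetaPertH ∧ nine spine estimates (0/9 proved); BetaPertH ⇐ (D1) ∧ (D4) ∧ CAP+tail;
G-an2-4 gates asym, D1 and NE2/3/4.  Row D1 ∕ (C1) OWNER an2, gen 55, 2026-08-24.  No existing file touched.
-/

noncomputable section

namespace Summit.QuantumFields.BalabanUV.Beta.CompositeOneShotTablesAnchor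

open Literature.MathematicalPhysics.QuantumFieldTheory
open Literature.MathematicalPhysics.QuantumFieldTheory.Balaban1983to89
open Literature.MathematicalPhysics.QuantumFieldTheory.Balaban1983to89.Beta
open AffineAveraging (Site box toSite)
open AveragingContoursRooted (ctr ctrOff ctrOff_mem_box)
open OneStepResolventKernel (TOf)
open OneStepKernelFamily (TshotOf TbalOf)
open BalabanStepW2 (wM1)
open Summit.QuantumFields.BalabanUV.Beta.SpineRooted (M1Of M1Of_apply)
open Summit.QuantumFields.BalabanUV.Beta.SymmetrisedStepJets (SymTables)
open Summit.QuantumFields.BalabanUV.Beta.SymSecondOrderTablesAn1 (symTablesAn1S2 symTablesAn1S2_V symTablesAn1S2_H symTablesAn1S2_M symTablesAn1S2_vh₂S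
  symTablesAn1S2_mixFF)
open Summit.QuantumFields.BalabanUV.Beta.SymTablesOf (tabsOf_M_apply)
open Summit.QuantumFields.BalabanUV.Beta.CombChartJointEnd (JsB12CombShSym)
open Summit.QuantumFields.BalabanUV.Beta.CombOneShotJetsTabs (JcOfTabs TOf_JsB12CombShSym_congr_heq TshotOf_JcOfTabs_one)
open Summit.QuantumFields.BalabanUV.Beta.CompositeOneShotJets (compH tabsComp tabsComp_V tabsComp_H tabsComp_vh₂S tabsComp_mixFF compV_one compH_one
  compB_ctrOff_one compMix_one)

/-! ## §1 A table record is its five data fields -/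

/-- [folklore] **EXTENSIONALITY OF THE TABLE RECORD IN ITS DATA FIELDS**: the ten letter fields of `SymTables d L` are propositions. -/
theorem symTables_ext {d L : ℕ} {t t' : SymTables d L} (hV : t.V = t'.V) (hH : t.H = t'.H) (hM : t.M = t'.M) (hB : t.vh₂S = t'.vh₂S)
    (hmix : t.mixFF = t'.mixFF) : t = t' := by
  cases t
  cases t'
  cases hV
  cases hH
  cases hM
  cases hB
  cases hmix
  rfl

/-- [folklore] **ACROSS AN EQUALITY OF BLOCKINGS** `n = m`: records with equal data fields are heterogeneously equal (the data fields' types do not mention the blocking). -/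
theorem symTables_heq_of_fields {d n m : ℕ} (h : n = m) {t : SymTables d n} {t' : SymTables d m} (hV : t.V = t'.V) (hH : t.H = t'.H) (hM : t.M = t'.M)
    (hB : t.vh₂S = t'.vh₂S) (hmix : t.mixFF = t'.mixFF) : HEq t t' := by
  subst h
  exact heq_of_eq (symTables_ext hV hH hM hB hmix)

/-! ## §2 (H-2): the depth-one composite record IS the (0.4) record -/

section Anchor

variable {Lc : ℕ} [NeZero Lc]

/-- [folklore] **(H-2) — THE DEPTH-ONE COMPOSITE TABLE RECORD AT THE CENTRED ROOT IS an1's (0.4) RECORD**, heterogeneously along `Lc¹ = Lc`: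
`tabsComp ctrOff Lc 1 (cΛ·wM1 3 Lc) ≅ symTablesAn1S2 3 Lc cΛ` — F6d-1b's four anchors field by field, the multiplier tables by `tabsOf`'s `cM j • H` against `M1Of_apply`. -/
theorem tabsComp_one_heq_symTablesAn1S2 (hLc : 1 ≤ Lc) (cΛ : ℝ) :
    HEq (tabsComp (r := ctrOff (3 + 1) Lc) (L := Lc) 1 hLc (ctrOff_mem_box hLc) (fun j => cΛ * wM1 3 Lc j)) (symTablesAn1S2 3 Lc cΛ) := by
  refine symTables_heq_of_fields (pow_one Lc) ?_ ?_ ?_ ?_ ?_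
  · rw [tabsComp_V, symTablesAn1S2_V]
    exact compV_one (ctrOff_mem_box hLc)
  · rw [tabsComp_H, symTablesAn1S2_H]
    exact compH_one (ctrOff_mem_box hLc)
  · rw [symTablesAn1S2_M]
    funext j μ w
    rw [M1Of_apply]
    show (cΛ * wM1 3 Lc j) • compH (ctrOff (3 + 1) Lc) Lc 1 μ w = _
    rw [compH_one (ctrOff_mem_box hLc)]
    rfl
  · rw [tabsComp_vh₂S, symTablesAn1S2_vh₂S]
    exact compB_ctrOff_one hLc
  · rw [tabsComp_mixFF, symTablesAn1S2_mixFF]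
    exact compMix_one (ctrOff_mem_box hLc)

end Anchor

/-! ## §3 Transported to the one-shot kernel -/

section Kernel

variable {Lc : ℕ} [NeZero Lc]

/-- [folklore] **THE LEVEL-0 ONE-SHOT KERNEL OF THE (III′) LITERAL OVER THE DEPTH-ONE COMPOSITE RECORD (blocking `Lc¹`) EQUALS THE ONE OVER an1's (0.4) RECORD (blocking `Lc`)**. -/
theorem TOf_JsB12CombShSym_tabsComp_one (hLc : Odd Lc) (N : ℕ) (cΛ c b : ℝ) :
    TOf (N := Lc ^ 1) (JsB12CombShSym (Lc := Lc ^ 1) hLc.pow N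
        (tabsComp (r := ctrOff (3 + 1) Lc) (L := Lc) 1 hLc.pos (ctrOff_mem_box hLc.pos) (fun j => cΛ * wM1 3 Lc j)) c b 0)
      = TOf (N := Lc) (JsB12CombShSym hLc N (symTablesAn1S2 3 Lc cΛ) c b 0) :=
  TOf_JsB12CombShSym_congr_heq hLc.pow hLc (pow_one Lc) N (tabsComp_one_heq_symTablesAn1S2 hLc.pos cΛ) c b

/-- [folklore] **`hbase` FOR ANY SCALE-INDEXED RECORD WHOSE SCALE-1 MEMBER IS THE DEPTH-ONE COMPOSITE RECORD**:
`TshotOf Lc (JcOfTabs hLc N tabs cΛ cB) 1 = TbalOf Lc (JsB12CombShSym hLc N (symTablesAn1S2 3 Lc (cΛ 1)) (cΛ 1) (cB 1)) 0`. -/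
theorem TshotOf_JcOfTabs_one_of_tabsComp (hLc : Odd Lc) (N : ℕ) (tabs : ∀ m : ℕ, SymTables 3 (Lc ^ m)) (cΛ cB : ℕ → ℝ)
    (h1 : tabs 1 = tabsComp (r := ctrOff (3 + 1) Lc) (L := Lc) 1 hLc.pos (ctrOff_mem_box hLc.pos) (fun j => cΛ 1 * wM1 3 Lc j)) :
    TshotOf Lc (JcOfTabs hLc N tabs cΛ cB) 1 = TbalOf Lc (JsB12CombShSym hLc N (symTablesAn1S2 3 Lc (cΛ 1)) (cΛ 1) (cB 1)) 0 :=
  TshotOf_JcOfTabs_one hLc N tabs cΛ cB _ (h1 ▸ tabsComp_one_heq_symTablesAn1S2 hLc.pos (cΛ 1))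

end Kernel

end Summit.QuantumFields.BalabanUV.Beta.CompositeOneShotTablesAnchor

end
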